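import Summits.HodgeConjecture.CorCM.MumfordTateRankSixCMRank
import Summits.HodgeConjecture.CorCM.MumfordTateRankThreeClassification
import Summits.HodgeConjecture.CorCM.MumfordTateRankTwo
import Summits.HodgeConjecture.CorCM.MumfordTateRankFour
import Summits.HodgeConjecture.CorCM.MumfordTateRankFourFactorDimension
import HarnessLib

/-!
# The rungs `dim MT(H¹(X)) ≤ 6`, VIII: the isogeny shapes of complex abelian varieties NOT of CM type with
# `dim MT(H¹X) = 4, 5, 6`

COR-CM (cell `pub-hodgecm2`, seat `b27` gen 38, count-neutral lane MT-RANK-SIX-CMPART; theorems only, no definition,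
no named fact; UNCONDITIONAL — nothing here uses or asserts HC_CM).  Read-off of `CorCM/MumfordTateRankSixCMRank`
(`X ∼ B^{m+1} × Z` with `dim MT(H¹Z) = dim MT(H¹X) − 3`) on the low rungs of the ladder, using the closed forms of the CM
rungs `dim MT = 2` (`mtRank_hodge_one_eq_two_iff`: `Z ∼ E^{N+1}`) and `dim MT = 3`
(`mtRank_hodge_one_eq_three_iff_surface_or_elliptic`: `Z ∼ S^{N+1}` or `Z ∼ E₁^a × E₂^b`).

Throughout `B` denotes a SIMPLE complex abelian variety NOT of CM type with `0 < dim B ≤ 2`, `dim_ℚ End⁰(B) = (dim B)²`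
and `Z(End⁰ B) = ℚ` — a non-CM elliptic curve (`End⁰ = ℚ`) or an abelian surface with quaternionic multiplication; its
Hodge group is `SL₂`.  For a complex abelian variety `X` with `0 < dim X`, NOT of CM type:

* **`shape_of_not_isOfCMType_of_mtRank_hodge_one_eq_six`** — `dim MT(H¹X) = 6` ⟹ `X ∼ B^{m+1} × S^{N+1}` with `S` a
  SIMPLE abelian SURFACE of CM type, OR `X ∼ B^{m+1} × ∏_j E_{cls j}` with `E₀ ≁ E₁` two CM elliptic curves both occurring
  (Hodge group `SL₂ · T²`: the NEW rung);
* `shape_of_not_isOfCMType_of_mtRank_hodge_one_eq_five'` — `dim MT(H¹X) = 5` ⟹ `X ∼ B^{m+1} × E^{N+1}`, `E` a CM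
  elliptic curve (`SL₂ · U(1)`; gen 33's rung re-derived from the CM-part rank);
* **`shape_of_not_isOfCMType_of_mtRank_le_six`** — the trichotomy for `dim MT(H¹X) ≤ 6`: `= 4` and `X ∼ B^{m+1}`, or
  `= 5` and `X ∼ B^{m+1} × E^{N+1}`, or `= 6` and one of the two shapes above.

(The converse — each listed shape is not of CM type with the stated Mumford–Tate rank — is the business of the sequel.)

## References

* [MoonenZarhin1999LowDim] B. Moonen, Yu. Zarhin, *Hodge classes on abelian varieties of low dimension*, Math. Ann.
  315 (1999), §2 (2.1)–(2.5).
* [MumfordAV1970] D. Mumford, *Abelian Varieties* (1970), §19 Thm. 1, Cor. 1–2 (pp. 173–174).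
* [Deligne1982HodgeCycles] P. Deligne, *Hodge cycles on abelian varieties*, LNM 900 (1982), I §3 Prop. 3.4, Ex. 3.7,
  §5 Prop. 5.1.
* [Gordon1999HodgeAVSurvey] B. B. Gordon, *A survey of the Hodge conjecture for abelian varieties* (1999), 7.4–7.7.
-/

noncomputable section

open CategoryTheory CategoryTheory.Limits Module

namespace Summit.HodgeConjecture.CorCM

open Literature.AlgebraicGeometry.Motives
open Literature.AlgebraicGeometry.Motives.AbelianVariety
open Literature.AlgebraicGeometry.Motives.HodgeStructure
open Literature.AlgebraicGeometry.HodgeTheory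
open Literature.AlgebraicGeometry.Milne1999 (IsOfCMType)

variable [HodgeTensorFacts.{0, 0}] {X : AbelianVariety ℂ} {n : ℕ}

/-! ## §1 The rung `dim MT(H¹X) = 6` -/

/-- **The rung `dim MT(H¹(X)) = 6`, `X` NOT of CM type: `X ∼ B^{m+1} × S^{N+1}` or `X ∼ B^{m+1} × E₀^{a} × E₁^{b}`.**
Precisely: there are a SIMPLE `B`, NOT of CM type, with `0 < dim B ≤ 2`, `dim_ℚ End⁰(B) = (dim B)²`, `Z(End⁰ B) = ℚ`
(non-CM elliptic curve or QM surface) and `m`, such that EITHER `X ∼ B^{m+1} × S^{N+1}` for a SIMPLE abelian SURFACE `S`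
of CM type, OR `X ∼ B^{m+1} × ⨁_j E_{cls j}` for two NON-isogenous CM elliptic curves `E₀, E₁`, both occurring.  (The CM
part `Z` of `CorCM/MumfordTateRankSixCMRank` has `dim MT(H¹Z) = 6 − 3 = 3`, and `mtRank_hodge_one_eq_three_iff_surface_or_elliptic`.)
[cite: MoonenZarhin1999LowDim, §2 (2.1)–(2.5)] [cite: MumfordAV1970, §19 Thm. 1, Cor. 1–2 (pp. 173–174)]
[cite: Gordon1999HodgeAVSurvey, 7.4–7.7] -/
theorem shape_of_not_isOfCMType_of_mtRank_hodge_one_eq_six (hX : IsSmoothProjective n X.X) (h0 : 0 < X.dim)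
    (hcm : ¬ IsOfCMType X)
    (h6 : haveI := BettiUniverse.finite hX 1
      (BettiUniverse.hodge exists_isReal_hodgeModel_holds hX 1).mtRank = 6) :
    ∃ (B : AbelianVariety ℂ) (m : ℕ), B.IsSimple ∧ 0 < B.dim ∧ B.dim ≤ 2 ∧ ¬ IsOfCMType B ∧
      Module.finrank ℚ B.endAlgebra = B.dim ^ 2 ∧ Module.finrank ℚ (Subalgebra.center ℚ B.endAlgebra) = 1 ∧
      ((∃ (S : AbelianVariety ℂ) (N : ℕ), S.IsSimple ∧ S.dim = 2 ∧ IsOfCMType S ∧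
          IsIsogenous X ((B.powSucc m).prod (S.powSucc N))) ∨
        (∃ (E : Fin 2 → AbelianVariety ℂ) (k : ℕ) (cls : Fin (k + 1) → Fin 2),
          (∀ i, (E i).dim = 1) ∧ (∀ i, IsOfCMType (E i)) ∧ ¬ IsIsogenous (E 0) (E 1) ∧ Function.Surjective cls ∧
          IsIsogenous X ((B.powSucc m).prod (⨁ fun j => E (cls j))))) := by
  haveI := BettiUniverse.finite hX 1
  obtain ⟨B, Z, m, hBs, hB0, hB2, hBcm, hfinB, hZB, -, hXYZ, -, hZ0, -, -, hmt, -⟩ :=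
    exists_isIsogenous_powSucc_prod_finrank_hodgeLie_of_mtRank_le_six hX h0 hcm (by omega)
  have hZpos : 0 < Z.dim := by
    rcases Nat.eq_zero_or_pos Z.dim with h | h
    · exact absurd (hZ0.1 h) (by omega)
    · exact h
  have hZ3 : haveI := BettiUniverse.finite (AbelianVariety.isSmoothProjective_holds (A := Z)) 1
      (BettiUniverse.hodge exists_isReal_hodgeModel_holds (AbelianVariety.isSmoothProjective_holds (A := Z)) 1).mtRank = 3 := by
    have := hmt hZpos
    omega
  refine ⟨B, m, hBs, hB0, hB2, hBcm, hfinB, hZB, ?_⟩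
  rcases (mtRank_hodge_one_eq_three_iff_surface_or_elliptic AbelianVariety.isSmoothProjective_holds hZpos).1 hZ3 with
    ⟨S, hSs, hS2, hScm, N, hZS⟩ | ⟨E, hE1, hEcm, hEni, k, cls, hcls, hZE⟩
  · exact Or.inl ⟨S, N, hSs, hS2, hScm, hXYZ.trans ((IsIsogenous.refl _).prod hZS)⟩
  · exact Or.inr ⟨E, k, cls, hE1, hEcm, hEni, hcls, hXYZ.trans ((IsIsogenous.refl _).prod hZE)⟩

/-! ## §2 The rung `dim MT(H¹X) = 5`, re-derived -/

/-- **The rung `dim MT(H¹(X)) = 5`, `X` NOT of CM type: `X ∼ B^{m+1} × E^{N+1}`** with `E` a CM elliptic curve (the CM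
part has `dim MT(H¹Z) = 2`, `mtRank_hodge_one_eq_two_iff`).  Gen 33's `exists_isIsogenous_two_powers_of_finrank_hodgeLie_eq_four`
(family form) re-derived in product form from the CM-part rank. [cite: MoonenZarhin1999LowDim, §2 (2.1)–(2.5)]
[cite: Deligne1982HodgeCycles, I Prop. 3.4 and Ex. 3.7] -/
theorem shape_of_not_isOfCMType_of_mtRank_hodge_one_eq_five' (hX : IsSmoothProjective n X.X) (h0 : 0 < X.dim)
    (hcm : ¬ IsOfCMType X)
    (h5 : haveI := BettiUniverse.finite hX 1
      (BettiUniverse.hodge exists_isReal_hodgeModel_holds hX 1).mtRank = 5) :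
    ∃ (B : AbelianVariety ℂ) (m : ℕ) (E : AbelianVariety ℂ) (N : ℕ), B.IsSimple ∧ 0 < B.dim ∧ B.dim ≤ 2 ∧
      ¬ IsOfCMType B ∧ Module.finrank ℚ B.endAlgebra = B.dim ^ 2 ∧
      Module.finrank ℚ (Subalgebra.center ℚ B.endAlgebra) = 1 ∧ E.dim = 1 ∧ IsOfCMType E ∧
      IsIsogenous X ((B.powSucc m).prod (E.powSucc N)) := by
  haveI := BettiUniverse.finite hX 1
  obtain ⟨B, Z, m, hBs, hB0, hB2, hBcm, hfinB, hZB, -, hXYZ, -, hZ0, -, -, hmt, -⟩ :=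
    exists_isIsogenous_powSucc_prod_finrank_hodgeLie_of_mtRank_le_six hX h0 hcm (by omega)
  have hZpos : 0 < Z.dim := by
    rcases Nat.eq_zero_or_pos Z.dim with h | h
    · exact absurd (hZ0.1 h) (by omega)
    · exact h
  have hZ2 : haveI := BettiUniverse.finite (AbelianVariety.isSmoothProjective_holds (A := Z)) 1
      (BettiUniverse.hodge exists_isReal_hodgeModel_holds (AbelianVariety.isSmoothProjective_holds (A := Z)) 1).mtRank = 2 := by
    have := hmt hZpos
    omega
  obtain ⟨E, N, hE1, hEcm, hZE⟩ := (mtRank_hodge_one_eq_two_iff AbelianVariety.isSmoothProjective_holds hZpos).1 hZ2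
  exact ⟨B, m, E, N, hBs, hB0, hB2, hBcm, hfinB, hZB, hE1, hEcm, hXYZ.trans ((IsIsogenous.refl _).prod hZE)⟩

/-! ## §3 The trichotomy `dim MT(H¹X) ≤ 6` -/

/-- **The isogeny shapes of complex abelian varieties NOT of CM type with `dim MT(H¹(X)) ≤ 6`** (`0 < dim X`; then
`dim MT ≥ 4`, `four_le_mtRank_hodge_one_of_not_isOfCMType`).  With `B` SIMPLE, NOT of CM type, `0 < dim B ≤ 2`,
`dim_ℚ End⁰(B) = (dim B)²`, `Z(End⁰ B) = ℚ` (Hodge group `SL₂`):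
* `dim MT = 4` and `X ∼ B^{m+1}` (`Hg = SL₂`; Moonen–Zarhin (2.1)–(2.3));
* `dim MT = 5` and `X ∼ B^{m+1} × E^{N+1}`, `E` a CM elliptic curve (`Hg = SL₂ · U(1)`; (2.4)–(2.5));
* `dim MT = 6` and `X ∼ B^{m+1} × S^{N+1}`, `S` a simple CM surface, or `X ∼ B^{m+1} × ⨁_j E_{cls j}` with `E₀ ≁ E₁` CM
  elliptic curves both occurring (`Hg = SL₂ · T²`).
[cite: MoonenZarhin1999LowDim, §2 (2.1)–(2.5)] [cite: MumfordAV1970, §19 Thm. 1, Cor. 1–2 (pp. 173–174)]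
[cite: Gordon1999HodgeAVSurvey, 7.4–7.7] -/
theorem shape_of_not_isOfCMType_of_mtRank_le_six (hX : IsSmoothProjective n X.X) (h0 : 0 < X.dim)
    (hcm : ¬ IsOfCMType X)
    (h6 : haveI := BettiUniverse.finite hX 1
      (BettiUniverse.hodge exists_isReal_hodgeModel_holds hX 1).mtRank ≤ 6) :
    haveI := BettiUniverse.finite hX 1
    ((BettiUniverse.hodge exists_isReal_hodgeModel_holds hX 1).mtRank = 4 ∧
        ∃ (B : AbelianVariety ℂ) (m : ℕ), B.IsSimple ∧ 0 < B.dim ∧ B.dim ≤ 2 ∧ ¬ IsOfCMType B ∧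
          Module.finrank ℚ B.endAlgebra = B.dim ^ 2 ∧ Module.finrank ℚ (Subalgebra.center ℚ B.endAlgebra) = 1 ∧
          IsIsogenous X (⨁ fun _ : Fin (m + 1) => B)) ∨
      ((BettiUniverse.hodge exists_isReal_hodgeModel_holds hX 1).mtRank = 5 ∧
        ∃ (B : AbelianVariety ℂ) (m : ℕ) (E : AbelianVariety ℂ) (N : ℕ), B.IsSimple ∧ 0 < B.dim ∧ B.dim ≤ 2 ∧
          ¬ IsOfCMType B ∧ Module.finrank ℚ B.endAlgebra = B.dim ^ 2 ∧
          Module.finrank ℚ (Subalgebra.center ℚ B.endAlgebra) = 1 ∧ E.dim = 1 ∧ IsOfCMType E ∧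
          IsIsogenous X ((B.powSucc m).prod (E.powSucc N))) ∨
      ((BettiUniverse.hodge exists_isReal_hodgeModel_holds hX 1).mtRank = 6 ∧
        ∃ (B : AbelianVariety ℂ) (m : ℕ), B.IsSimple ∧ 0 < B.dim ∧ B.dim ≤ 2 ∧ ¬ IsOfCMType B ∧
          Module.finrank ℚ B.endAlgebra = B.dim ^ 2 ∧ Module.finrank ℚ (Subalgebra.center ℚ B.endAlgebra) = 1 ∧
          ((∃ (S : AbelianVariety ℂ) (N : ℕ), S.IsSimple ∧ S.dim = 2 ∧ IsOfCMType S ∧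
              IsIsogenous X ((B.powSucc m).prod (S.powSucc N))) ∨
            (∃ (E : Fin 2 → AbelianVariety ℂ) (k : ℕ) (cls : Fin (k + 1) → Fin 2),
              (∀ i, (E i).dim = 1) ∧ (∀ i, IsOfCMType (E i)) ∧ ¬ IsIsogenous (E 0) (E 1) ∧ Function.Surjective cls ∧
              IsIsogenous X ((B.powSucc m).prod (⨁ fun j => E (cls j)))))) := by
  haveI := BettiUniverse.finite hX 1
  have h4 := four_le_mtRank_hodge_one_of_not_isOfCMType hX hcm
  set t := (BettiUniverse.hodge exists_isReal_hodgeModel_holds hX 1).mtRank with ht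
  rcases (show t = 4 ∨ t = 5 ∨ t = 6 by omega) with h | h | h
  · refine Or.inl ⟨h, ?_⟩
    obtain ⟨B, m, hBs, hB0, hBcm, hXB, -, hfinB, hZB⟩ := exists_isIsogenous_power_of_not_isOfCMType hX h0 hcm (le_of_eq h)
    exact ⟨B, m, hBs, hB0, dim_le_two_of_finrank_endAlgebra_eq_sq hBs hB0 hfinB, hBcm, hfinB, hZB, hXB⟩
  · exact Or.inr (Or.inl ⟨h, shape_of_not_isOfCMType_of_mtRank_hodge_one_eq_five' hX h0 hcm h⟩)
  · exact Or.inr (Or.inr ⟨h, shape_of_not_isOfCMType_of_mtRank_hodge_one_eq_six hX h0 hcm h⟩)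

end Summit.HodgeConjecture.CorCM

end
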